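import Summits.CriticalPhenomena.PercolationContinuityZ3.Theorems.PercNearOneGluingNoHeavyLowerTailKNGoodGMgcCertificate
import Summits.CriticalPhenomena.PercolationContinuityZ3.Theorems.PercNearOneGluingNoHeavyLowerTailSBTensExpr
import Summits.CriticalPhenomena.PercolationContinuityZ3.Theorems.PercNearOneGluingNoHeavyLowerTailKNGoodGMgcSideFrame
import HarnessLib

/-!
# The BLOB KERNEL certificates: the all-children star of a three-children observer (|A| = 3)
# (`NoHeavyLowerTail` cell, stmt-CriticalPhenomena-4575; prover `prim-hp-2`, gen 19 — KEY3 of MEMO-gen19 §6–7, certificate layer)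

Support file (`--supports stmt-CriticalPhenomena-4575`; COMPUTATIONAL: two packed `SBTens` checks + small `decide`d tables).  Small computable
definitions (`inS`, the blob cell table `blobHat`, the indicators `iA, iB2, iC2, iB3, iE3`, two `PE` certificates), no named facts, no sorries.
SETTING (MEMO-gen19 §7).  `K = C + x + y + z + pairs` as in THEOREM B; the observer is the BLOB `[xyz]` (all three children glued to `o`): its hit set
is `S = hits(x) ∪ hits(y) ∪ hits(z)` (merged hairs `h_a = 1−(1−x_a)(1−y_a)(1−z_a)`, independent across relays), the inner pairs are invisible, and the
goodness functional at the witness `a_j` is `Σ_v Ψ_v(j)·v_v` with `Ψ_v(j) = E[blobHat j · v]` (cells: `S = {a}` ↦ `rel_0(a) − rel_0(a_j)`,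
`S = {a,a'}` ↦ `rel_[aa']([aa']) − rel_[aa'](a_j)`, `S = A` ↦ `0`, `S = ∅` ↦ `rel_0(a₁) − rel_0(a_j)`).  Fourier–Motzkin with the two loneliness rows
of `j` and the cone needs NO condition for `j = 1`, ONE bilinear condition each for `j = 2, 3`:
  (K3-2) `E[iC2]·(Q_d+Q₂₃) ≥ E[iA]·Q₁₃`  (`iC2 = 1{1,3 ∈ S, 2 ∉ S}`, `iA = 1{2,3 ∉ S}`),   (K3-3) `E[iE3]·Q_d ≥ E[iA + iB3]·Q₁₂`
  (`iE3 = 1{S = {1,2}}`, `iB3 = 1{S = {2}}`), `Q` = world law of `K`'s side (`qHat`, twelve bits).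
* `k32_check`, `k33_check` — the two conditions as `SBTens.PE.fastCheck` (native_decide), `k32`, `k33` their real forms;
* `blobCoef` — `Ψ_v(j) = bexp 9 (blobHat j · v)`; coefficient tables `blobHat_coef_*` (`decide` over the 2⁹ hit patterns); dominations;
* **`blob_free_j1`, `blob_free_j2`, `blob_free_j3`** — `0 ≤ Σ_v Ψ_v(j) v_v` under the cone rows and the two loneliness rows of `j` (world-law form,
  exactly the hypotheses `h1/h2/h3` of `KNGoodGMgc.certificate_j*` / `free_j*`).
The semantic half (blob target expansion + corner (1,1,1)) turns these into KEY3 and closes UG(|A| = 3, |R| ≤ 4) (`…KNGoodGMgcThreeChildren`).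
-/

noncomputable section

namespace Summit.CriticalPhenomena.PercolationContinuityZ3.Theorems

namespace KNGoodGMgc

open SBTens
open scoped Classical

/-! ## The blob's hit set and cell table -/

/-- Relay `a ∈ {1,2,3}` is hit by the blob (some hair of `x`, `y` or `z` to `a` is present). [this work] -/
def inS (a : ℕ) (c : Cfg) : Bool :=
  if a = 1 then c 0 || c 3 || c 6 else if a = 2 then c 1 || c 4 || c 7 else c 2 || c 5 || c 8

/-- The blob's hit set as a mask. [this work] -/
def blobS (c : Cfg) : ℕ := hitX c ||| hitY c ||| hitZ c

/-- The blob cell 5-vector at a hair configuration (witness index `j`): `−dj1 j` if nothing is hit, else the f-table value of the cell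
`(worldOf [S], S)`. [this work] -/
def blobHat (j : ℕ) (c : Cfg) : Fin 5 → ℤ :=
  if blobS c = 0 then -dj1 j else ftab j (worldOf [blobS c]) (blobS c)

/-- `Ψ_v(j)`: the expectation of the `v`-component of `blobHat j` over the nine hair bits. [this work] -/
noncomputable def blobCoef (j : ℕ) (v : Fin 5) (x : ℕ → ℝ) : ℝ := bexp 9 (fun c => blobHat j c v) x

/-- `iA = 1{2 ∉ S, 3 ∉ S}`. [this work] -/
def iA (c : Cfg) : ℤ := if (!(inS 2 c) && !(inS 3 c)) = true then 1 else 0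
/-- `iB2 = 1{S = {3}}`. [this work] -/
def iB2 (c : Cfg) : ℤ := if (inS 3 c && !(inS 1 c) && !(inS 2 c)) = true then 1 else 0
/-- `iC2 = 1{1,3 ∈ S, 2 ∉ S}`. [this work] -/
def iC2 (c : Cfg) : ℤ := if (inS 1 c && inS 3 c && !(inS 2 c)) = true then 1 else 0
/-- `iB3 = 1{S = {2}}`. [this work] -/
def iB3 (c : Cfg) : ℤ := if (inS 2 c && !(inS 1 c) && !(inS 3 c)) = true then 1 else 0
/-- `iE3 = 1{S = {1,2}}`. [this work] -/
def iE3 (c : Cfg) : ℤ := if (inS 1 c && inS 2 c && !(inS 3 c)) = true then 1 else 0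
/-- `iP2 = 1{S = {2}}`, `iP3 = 1{S = {3}}`, `iP23 = 1{S = {2,3}}` (the cells of `j = 1`). [this work] -/
def iP23 (c : Cfg) : ℤ := if (inS 2 c && inS 3 c && !(inS 1 c)) = true then 1 else 0

/-- Nine-bit truncation. [this work] -/
def mk9 (b0 b1 b2 b3 b4 b5 b6 b7 b8 : Bool) : Cfg := mk12 b0 b1 b2 b3 b4 b5 b6 b7 b8 false false false

/-- The blob cell table in coordinates (check over the `2⁹` hit patterns):
`j=1: (iB3, iB2, 0, iP23, 0)·(α, α+β, ·, δ)` i.e. `Ψ(1) = (iB3 + iB2, iB2, 0, iP23, 0)`; `j=2: (−iA, iB2, iC2, 0, 0)`; `j=3: (−iA, −(iA+iB3), 0, 0, iE3)`.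
[this work] -/
theorem blobHat_table : ∀ b0 b1 b2 b3 b4 b5 b6 b7 b8 : Bool,
    (let c := mk9 b0 b1 b2 b3 b4 b5 b6 b7 b8
     (blobHat 1 c 0 == iB3 c + iB2 c) && (blobHat 1 c 1 == iB2 c) && (blobHat 1 c 2 == 0) && (blobHat 1 c 3 == iP23 c) &&
       (blobHat 1 c 4 == 0) &&
     (blobHat 2 c 0 == -iA c) && (blobHat 2 c 1 == iB2 c) && (blobHat 2 c 2 == iC2 c) && (blobHat 2 c 3 == 0) && (blobHat 2 c 4 == 0) &&
     (blobHat 3 c 0 == -iA c) && (blobHat 3 c 1 == -(iA c + iB3 c)) && (blobHat 3 c 2 == 0) && (blobHat 3 c 3 == 0) &&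
       (blobHat 3 c 4 == iE3 c)) = true := by
  decide


/-- `blobHat` reads only the nine hair bits. [this work] -/
theorem blobHat_trunc9 (j : ℕ) (c : Cfg) : blobHat j c = blobHat j (mk9 (c 0) (c 1) (c 2) (c 3) (c 4) (c 5) (c 6) (c 7) (c 8)) := by
  simp only [blobHat, blobS, hitX, hitY, hitZ, mk9, mk12]

/-- The indicators read only the nine hair bits. [this work] -/
theorem ind_trunc9 (c : Cfg) :
    iA c = iA (mk9 (c 0) (c 1) (c 2) (c 3) (c 4) (c 5) (c 6) (c 7) (c 8)) ∧ iB2 c = iB2 (mk9 (c 0) (c 1) (c 2) (c 3) (c 4) (c 5) (c 6) (c 7) (c 8)) ∧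
    iC2 c = iC2 (mk9 (c 0) (c 1) (c 2) (c 3) (c 4) (c 5) (c 6) (c 7) (c 8)) ∧ iB3 c = iB3 (mk9 (c 0) (c 1) (c 2) (c 3) (c 4) (c 5) (c 6) (c 7) (c 8)) ∧
    iE3 c = iE3 (mk9 (c 0) (c 1) (c 2) (c 3) (c 4) (c 5) (c 6) (c 7) (c 8)) ∧ iP23 c = iP23 (mk9 (c 0) (c 1) (c 2) (c 3) (c 4) (c 5) (c 6) (c 7) (c 8)) := by
  simp only [iA, iB2, iC2, iB3, iE3, iP23, inS, mk9, mk12]; simp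

/-- The coefficient identities at every configuration. [this work] -/
theorem blobHat_coef (c : Cfg) :
    blobHat 1 c 0 = iB3 c + iB2 c ∧ blobHat 1 c 1 = iB2 c ∧ blobHat 1 c 2 = 0 ∧ blobHat 1 c 3 = iP23 c ∧ blobHat 1 c 4 = 0 ∧
    blobHat 2 c 0 = -iA c ∧ blobHat 2 c 1 = iB2 c ∧ blobHat 2 c 2 = iC2 c ∧ blobHat 2 c 3 = 0 ∧ blobHat 2 c 4 = 0 ∧
    blobHat 3 c 0 = -iA c ∧ blobHat 3 c 1 = -(iA c + iB3 c) ∧ blobHat 3 c 2 = 0 ∧ blobHat 3 c 3 = 0 ∧ blobHat 3 c 4 = iE3 c := by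
  have h := blobHat_table (c 0) (c 1) (c 2) (c 3) (c 4) (c 5) (c 6) (c 7) (c 8)
  simp only [Bool.and_eq_true, beq_iff_eq] at h
  obtain ⟨⟨⟨⟨⟨⟨⟨⟨⟨⟨⟨⟨⟨⟨h1, h2⟩, h3⟩, h4⟩, h5⟩, h6⟩, h7⟩, h8⟩, h9⟩, h10⟩, h11⟩, h12⟩, h13⟩, h14⟩, h15⟩ := h
  obtain ⟨eA, eB2, eC2, eB3, eE3, eP23⟩ := ind_trunc9 c
  rw [blobHat_trunc9 1 c, blobHat_trunc9 2 c, blobHat_trunc9 3 c, eA, eB2, eC2, eB3, eE3, eP23]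
  exact ⟨h1, h2, h3, h4, h5, h6, h7, h8, h9, h10, h11, h12, h13, h14, h15⟩

/-! ## The two certificates -/

/-- (K3-2) as a polynomial expression: `E[iC2]·E[qHat [0,6]] − E[iA]·E[qHat [5]]`. [this work] -/
def k32PE : PE := .sub (.mul (.vert 9 iC2) (.vert 12 (qHat [0, 6]))) (.mul (.vert 9 iA) (.vert 12 (qHat [5])))
/-- (K3-3) as a polynomial expression: `E[iE3]·E[qHat [0]] − E[iA + iB3]·E[qHat [3]]`. [this work] -/
def k33PE : PE := .sub (.mul (.vert 9 iE3) (.vert 12 (qHat [0]))) (.mul (.vert 9 (fun c => iA c + iB3 c)) (.vert 12 (qHat [3])))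

/-- The packed check of (K3-2) (COMPUTATIONAL). [this work] -/
theorem k32_check : k32PE.fastCheck 32 12 = true := by native_decide
/-- The packed check of (K3-3) (COMPUTATIONAL). [this work] -/
theorem k33_check : k33PE.fastCheck 32 12 = true := by native_decide

/-- **(K3-2)**: `E[iA]·Q₁₃ ≤ E[iC2]·(Q_d + Q₂₃)` on `[0,1]¹²`. [this work] -/
theorem k32 (x : ℕ → ℝ) (hx : ∀ i, 0 ≤ x i ∧ x i ≤ 1) :
    bexp 9 iA x * worldQ 5 x ≤ bexp 9 iC2 x * (worldQ 0 x + worldQ 6 x) := by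
  have h := PE.nonneg_of_fastCheck 32 12 k32PE k32_check x hx
  simp only [k32PE, PE.reval] at h
  rw [← bexp_qHat_d23] 
  change 0 ≤ bexp 9 iC2 x * bexp 12 (qHat [0, 6]) x - bexp 9 iA x * bexp 12 (qHat [5]) x at h
  unfold worldQ; linarith

/-- **(K3-3)**: `E[iA + iB3]·Q₁₂ ≤ E[iE3]·Q_d` on `[0,1]¹²`. [this work] -/
theorem k33 (x : ℕ → ℝ) (hx : ∀ i, 0 ≤ x i ∧ x i ≤ 1) :
    (bexp 9 iA x + bexp 9 iB3 x) * worldQ 3 x ≤ bexp 9 iE3 x * worldQ 0 x := by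
  have h := PE.nonneg_of_fastCheck 32 12 k33PE k33_check x hx
  simp only [k33PE, PE.reval] at h
  change 0 ≤ bexp 9 iE3 x * bexp 12 (qHat [0]) x - bexp 9 (fun c => iA c + iB3 c) x * bexp 12 (qHat [3]) x at h
  rw [bexp_add] at h
  unfold worldQ; linarith

/-! ## Dominations: cells that live on world `d` (or `d ∪ [12]`) -/

/-- The domination table: `iA, iB3 ⇒ world d`; `iE3 ⇒ world d or [12]` (check over `2¹²`). [this work] -/
theorem blobDom_table : ∀ b0 b1 b2 b3 b4 b5 b6 b7 b8 b9 b10 b11 : Bool,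
    (let c := mk12 b0 b1 b2 b3 b4 b5 b6 b7 b8 b9 b10 b11
     (iA c == 0 || qHat [0] c == 1) && (iB3 c == 0 || qHat [0] c == 1) && (iE3 c == 0 || qHat [0, 3] c == 1)) = true := by
  decide

/-- A `{0,1}`-valued integrand dominated by a `{0,1}`-valued one with zero expectation has zero expectation. [folklore] -/
theorem bexp9_eq_zero_of_dom (f g : Cfg → ℤ) (hf : ∀ c, f c = 0 ∨ f c = 1) (hg : ∀ c, 0 ≤ g c) (hdom : ∀ c, f c = 0 ∨ g c = 1)
    (hdep : DepOn (fun i => i < 9) f) (x : ℕ → ℝ) (hx : ∀ i, 0 ≤ x i ∧ x i ≤ 1) (h0 : bexp 12 g x = 0) : bexp 9 f x = 0 := by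
  have e : bexp 9 f x = bexp 12 f x := (bexp_of_dep_lt 9 f hdep 12 (by norm_num) x).symm
  have h1 : 0 ≤ bexp 12 (fun c => g c - f c) x := bexp_nonneg_of_pointwise 12 _ (fun c => by
    rcases hdom c with h | h
    · rw [h]; linarith [hg c]
    · rcases hf c with h' | h'
      · rw [h, h']; norm_num
      · rw [h, h']; norm_num) x hx
  have h2 : 0 ≤ bexp 12 f x := bexp_nonneg_of_pointwise 12 _ (fun c => by
    rcases hf c with h | h
    · rw [h]
    · rw [h]; norm_num) x hx
  rw [bexp_sub, h0] at h1
  rw [e]; linarith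

/-- Values and dependencies of the indicators. [this work] -/
theorem ind_facts :
    (∀ c, iA c = 0 ∨ iA c = 1) ∧ (∀ c, iB3 c = 0 ∨ iB3 c = 1) ∧ (∀ c, iE3 c = 0 ∨ iE3 c = 1) ∧
    DepOn (fun i => i < 9) iA ∧ DepOn (fun i => i < 9) iB3 ∧ DepOn (fun i => i < 9) iE3 := by
  refine ⟨fun c => ?_, fun c => ?_, fun c => ?_, fun c c' h => ?_, fun c c' h => ?_, fun c c' h => ?_⟩
  · unfold iA; split_ifs <;> simp
  · unfold iB3; split_ifs <;> simp
  · unfold iE3; split_ifs <;> simp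
  all_goals simp only [iA, iB3, iE3, inS, h 0 (by norm_num), h 1 (by norm_num), h 2 (by norm_num), h 3 (by norm_num), h 4 (by norm_num),
    h 5 (by norm_num), h 6 (by norm_num), h 7 (by norm_num), h 8 (by norm_num)]

/-- `Q_d = 0 ⇒ E[iA] = 0`, `Q_d = 0 ⇒ E[iB3] = 0`, `Q_d + Q₁₂ = 0 ⇒ E[iE3] = 0`. [this work] -/
theorem blob_dominations (x : ℕ → ℝ) (hx : ∀ i, 0 ≤ x i ∧ x i ≤ 1) :
    (worldQ 0 x = 0 → bexp 9 iA x = 0) ∧ (worldQ 0 x = 0 → bexp 9 iB3 x = 0) ∧ (worldQ 0 x + worldQ 3 x = 0 → bexp 9 iE3 x = 0) := by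
  obtain ⟨vA, vB3, vE3, dA, dB3, dE3⟩ := ind_facts
  have tab : ∀ c : Cfg, (iA c = 0 ∨ qHat [0] c = 1) ∧ (iB3 c = 0 ∨ qHat [0] c = 1) ∧ (iE3 c = 0 ∨ qHat [0, 3] c = 1) := by
    intro c
    have h := blobDom_table (c 0) (c 1) (c 2) (c 3) (c 4) (c 5) (c 6) (c 7) (c 8) (c 9) (c 10) (c 11)
    simp only [Bool.and_eq_true, Bool.or_eq_true, beq_iff_eq] at h
    obtain ⟨eA, -, -, eB3, eE3, -⟩ := ind_trunc9 c
    have hq : ∀ ws, qHat ws c = qHat ws (mk12 (c 0) (c 1) (c 2) (c 3) (c 4) (c 5) (c 6) (c 7) (c 8) (c 9) (c 10) (c 11)) := fun ws => by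
      unfold qHat; rw [sideWorld_trunc c]; rfl
    rw [eA, eB3, eE3, hq [0], hq [0, 3]]
    exact ⟨h.1.1, h.1.2, h.2⟩
  have q0 : ∀ c, 0 ≤ qHat [0] c := fun c => by unfold qHat; split_ifs <;> norm_num
  have q03 : ∀ c, 0 ≤ qHat [0, 3] c := fun c => by unfold qHat; split_ifs <;> norm_num
  refine ⟨fun h0 => bexp9_eq_zero_of_dom iA (qHat [0]) vA q0 (fun c => (tab c).1) dA x hx h0,
    fun h0 => bexp9_eq_zero_of_dom iB3 (qHat [0]) vB3 q0 (fun c => (tab c).2.1) dB3 x hx h0,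
    fun h0 => bexp9_eq_zero_of_dom iE3 (qHat [0, 3]) vE3 q03 (fun c => (tab c).2.2) dE3 x hx ?_⟩
  have : qHat [0, 3] = fun c => qHat [0] c + qHat [3] c := by funext c; exact qHat_pair 0 3 (by norm_num) c
  rw [this, bexp_add]; exact h0

/-! ## The blob kernel on the algebraic side -/

/-- Expectations of the indicators are nonnegative. [this work] -/
theorem bexp9_ind_nonneg (x : ℕ → ℝ) (hx : ∀ i, 0 ≤ x i ∧ x i ≤ 1) :
    0 ≤ bexp 9 iA x ∧ 0 ≤ bexp 9 iB2 x ∧ 0 ≤ bexp 9 iC2 x ∧ 0 ≤ bexp 9 iB3 x ∧ 0 ≤ bexp 9 iE3 x ∧ 0 ≤ bexp 9 iP23 x := by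
  refine ⟨?_, ?_, ?_, ?_, ?_, ?_⟩ <;> refine bexp_nonneg_of_pointwise 9 _ (fun c => ?_) x hx <;>
    first | (unfold iA; split_ifs <;> norm_num) | (unfold iB2; split_ifs <;> norm_num) | (unfold iC2; split_ifs <;> norm_num) |
      (unfold iB3; split_ifs <;> norm_num) | (unfold iE3; split_ifs <;> norm_num) | (unfold iP23; split_ifs <;> norm_num)

/-- The coefficients `Ψ_v(j)` in terms of the indicator expectations. [this work] -/
theorem blobCoef_eq (x : ℕ → ℝ) :
    blobCoef 1 0 x = bexp 9 iB3 x + bexp 9 iB2 x ∧ blobCoef 1 1 x = bexp 9 iB2 x ∧ blobCoef 1 2 x = 0 ∧ blobCoef 1 3 x = bexp 9 iP23 x ∧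
    blobCoef 1 4 x = 0 ∧ blobCoef 2 0 x = -bexp 9 iA x ∧ blobCoef 2 1 x = bexp 9 iB2 x ∧ blobCoef 2 2 x = bexp 9 iC2 x ∧ blobCoef 2 3 x = 0 ∧
    blobCoef 2 4 x = 0 ∧ blobCoef 3 0 x = -bexp 9 iA x ∧ blobCoef 3 1 x = -(bexp 9 iA x + bexp 9 iB3 x) ∧ blobCoef 3 2 x = 0 ∧
    blobCoef 3 3 x = 0 ∧ blobCoef 3 4 x = bexp 9 iE3 x := by
  have c0 : bexp 9 (fun _ => (0 : ℤ)) x = 0 := by rw [bexp_const]; simp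
  unfold blobCoef
  refine ⟨?_, ?_, ?_, ?_, ?_, ?_, ?_, ?_, ?_, ?_, ?_, ?_, ?_, ?_, ?_⟩
  · rw [bexp_congr 9 (fun c => (blobHat_coef c).1), bexp_add]
  · rw [bexp_congr 9 (fun c => (blobHat_coef c).2.1)]
  · rw [bexp_congr 9 (fun c => (blobHat_coef c).2.2.1), c0]
  · rw [bexp_congr 9 (fun c => (blobHat_coef c).2.2.2.1)]
  · rw [bexp_congr 9 (fun c => (blobHat_coef c).2.2.2.2.1), c0]
  · rw [bexp_congr 9 (fun c => (blobHat_coef c).2.2.2.2.2.1), bexp_neg]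
  · rw [bexp_congr 9 (fun c => (blobHat_coef c).2.2.2.2.2.2.1)]
  · rw [bexp_congr 9 (fun c => (blobHat_coef c).2.2.2.2.2.2.2.1)]
  · rw [bexp_congr 9 (fun c => (blobHat_coef c).2.2.2.2.2.2.2.2.1), c0]
  · rw [bexp_congr 9 (fun c => (blobHat_coef c).2.2.2.2.2.2.2.2.2.1), c0]
  · rw [bexp_congr 9 (fun c => (blobHat_coef c).2.2.2.2.2.2.2.2.2.2.1), bexp_neg]
  · rw [bexp_congr 9 (fun c => (blobHat_coef c).2.2.2.2.2.2.2.2.2.2.2.1), bexp_neg, bexp_add]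
  · rw [bexp_congr 9 (fun c => (blobHat_coef c).2.2.2.2.2.2.2.2.2.2.2.2.1), c0]
  · rw [bexp_congr 9 (fun c => (blobHat_coef c).2.2.2.2.2.2.2.2.2.2.2.2.2.1), c0]
  · rw [bexp_congr 9 (fun c => (blobHat_coef c).2.2.2.2.2.2.2.2.2.2.2.2.2.2)]

/-- **Blob kernel, `j = 1`** (witness = core-loneliest: Kozma–Nitzan's Theorem 4 — no hypothesis needed beyond the cone). [this work] -/
theorem blob_free_j1 (x : ℕ → ℝ) (hx : ∀ i, 0 ≤ x i ∧ x i ≤ 1) (α β γ δ ε : ℝ) (hα : 0 ≤ α) (hβ : 0 ≤ β) (hδ : α ≤ δ) :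
    0 ≤ blobCoef 1 0 x * α + blobCoef 1 1 x * β + blobCoef 1 2 x * γ + blobCoef 1 3 x * δ + blobCoef 1 4 x * ε := by
  obtain ⟨e0, e1, e2, e3, e4, -⟩ := blobCoef_eq x
  obtain ⟨nA, nB2, nC2, nB3, nE3, nP23⟩ := bexp9_ind_nonneg x hx
  rw [e0, e1, e2, e3, e4]
  have hδ0 : 0 ≤ δ := le_trans hα hδ
  nlinarith [mul_nonneg nB3 hα, mul_nonneg nB2 hα, mul_nonneg nB2 hβ, mul_nonneg nP23 hδ0]

/-- **Blob kernel, `j = 2`**: under the cone and the row `P(1) − P(2) ≥ 0` (`0 ≤ −Q_dα + Q₁₃γ − Q₂₃δ`). [this work] -/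
theorem blob_free_j2 (x : ℕ → ℝ) (hx : ∀ i, 0 ≤ x i ∧ x i ≤ 1) (α β γ δ ε : ℝ) (hα : 0 ≤ α) (hβ : 0 ≤ β) (hγ : 0 ≤ γ) (hδ : α ≤ δ)
    (h1 : 0 ≤ -worldQ 0 x * α + worldQ 5 x * γ - worldQ 6 x * δ) :
    0 ≤ blobCoef 2 0 x * α + blobCoef 2 1 x * β + blobCoef 2 2 x * γ + blobCoef 2 3 x * δ + blobCoef 2 4 x * ε := by
  obtain ⟨-, -, -, -, -, e0, e1, e2, e3, e4, -⟩ := blobCoef_eq x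
  obtain ⟨nA, nB2, nC2, -, -, -⟩ := bexp9_ind_nonneg x hx
  have hQ0 := worldQ_nonneg 0 x hx; have hQ5 := worldQ_nonneg 5 x hx; have hQ6 := worldQ_nonneg 6 x hx
  rw [e0, e1, e2, e3, e4]
  have K := k32 x hx
  by_cases h5 : 0 < worldQ 5 x
  · -- main case: `γ ≥ (Q_d+Q₂₃)α / Q₁₃` and (K3-2)
    have hδ0 : 0 ≤ δ := le_trans hα hδ
    have t1 : worldQ 5 x * γ ≥ (worldQ 0 x + worldQ 6 x) * α := by nlinarith [mul_nonneg hQ6 (sub_nonneg.2 hδ)]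
    have t2 : worldQ 5 x * (bexp 9 iC2 x * γ - bexp 9 iA x * α) ≥ 0 := by
      nlinarith [mul_nonneg nC2 (sub_nonneg.2 (show (worldQ 0 x + worldQ 6 x) * α ≤ worldQ 5 x * γ from t1)), mul_nonneg hα
        (sub_nonneg.2 K)]
    have t3 : 0 ≤ bexp 9 iC2 x * γ - bexp 9 iA x * α := by
      by_contra hneg; push Not at hneg; nlinarith [mul_pos h5 (neg_pos.2 hneg)]
    nlinarith [mul_nonneg nB2 hβ, t3]
  · -- corner `Q₁₃ = 0`: the row kills `Q_d α`; `iA` lives on world `d`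
    have hQ5' : worldQ 5 x = 0 := le_antisymm (not_lt.1 h5) hQ5
    rw [hQ5'] at h1
    have hδ0 : 0 ≤ δ := le_trans hα hδ
    have hQ0α : worldQ 0 x * α = 0 := by nlinarith [mul_nonneg hQ0 hα, mul_nonneg hQ6 hδ0]
    have hAα : bexp 9 iA x * α = 0 := by
      by_cases h0 : worldQ 0 x = 0
      · rw [(blob_dominations x hx).1 h0, zero_mul]
      · rcases mul_eq_zero.1 hQ0α with h | h
        · exact absurd h h0
        · rw [h, mul_zero]
    nlinarith [mul_nonneg nB2 hβ, mul_nonneg nC2 hγ, hAα]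

/-- **Blob kernel, `j = 3`**: under the cone (with `−β ≤ ε`) and the rows `P(1) − P(3) ≥ 0`, `P(2) − P(3) ≥ 0`. [this work] -/
theorem blob_free_j3 (x : ℕ → ℝ) (hx : ∀ i, 0 ≤ x i ∧ x i ≤ 1) (α β γ δ ε : ℝ) (hα : 0 ≤ α) (hβ : 0 ≤ β) (hδ : α ≤ δ)
    (hε : -β ≤ ε)
    (h1 : 0 ≤ -worldQ 0 x * (α + β) + worldQ 3 x * ε - worldQ 6 x * δ)
    (h2 : 0 ≤ -worldQ 0 x * β + worldQ 3 x * ε - worldQ 5 x * γ) :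
    0 ≤ blobCoef 3 0 x * α + blobCoef 3 1 x * β + blobCoef 3 2 x * γ + blobCoef 3 3 x * δ + blobCoef 3 4 x * ε := by
  obtain ⟨-, -, -, -, -, -, -, -, -, -, e0, e1, e2, e3, e4⟩ := blobCoef_eq x
  obtain ⟨nA, -, -, nB3, nE3, -⟩ := bexp9_ind_nonneg x hx
  have hQ0 := worldQ_nonneg 0 x hx; have hQ3 := worldQ_nonneg 3 x hx; have hQ5 := worldQ_nonneg 5 x hx
  have hQ6 := worldQ_nonneg 6 x hx
  rw [e0, e1, e2, e3, e4]
  have K := k33 x hx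
  have hδ0 : 0 ≤ δ := le_trans hα hδ
  by_cases h3 : 0 < worldQ 3 x
  · -- main case: `Q₁₂ ε ≥ Q_d (α+β)` and (K3-3)
    have t1 : worldQ 3 x * ε ≥ worldQ 0 x * (α + β) := by nlinarith [mul_nonneg hQ6 hδ0]
    -- target: -A α - (A+B3) β + E3 ε ≥ 0; multiply by Q₁₂ > 0
    have t2 : worldQ 3 x * (bexp 9 iE3 x * ε) ≥ bexp 9 iE3 x * (worldQ 0 x * (α + β)) := by nlinarith [mul_nonneg nE3 (sub_nonneg.2 t1)]
    have t3 : bexp 9 iE3 x * (worldQ 0 x * (α + β)) ≥ (bexp 9 iA x + bexp 9 iB3 x) * worldQ 3 x * (α + β) := by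
      nlinarith [mul_nonneg (add_nonneg hα hβ) (sub_nonneg.2 K)]
    have t4 : worldQ 3 x * (bexp 9 iE3 x * ε - bexp 9 iA x * α - (bexp 9 iA x + bexp 9 iB3 x) * β) ≥ 0 := by
      nlinarith [t2, t3, mul_nonneg (mul_nonneg nB3 hQ3) hα]
    have t5 : 0 ≤ bexp 9 iE3 x * ε - bexp 9 iA x * α - (bexp 9 iA x + bexp 9 iB3 x) * β := by
      by_contra hneg; push Not at hneg; nlinarith [mul_pos h3 (neg_pos.2 hneg)]
    linarith
  · -- corner `Q₁₂ = 0`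
    have hQ3' : worldQ 3 x = 0 := le_antisymm (not_lt.1 h3) hQ3
    rw [hQ3'] at h1 h2
    have hQ0α : worldQ 0 x * α = 0 := by nlinarith [mul_nonneg hQ0 hα, mul_nonneg hQ0 hβ, mul_nonneg hQ6 hδ0]
    have hQ0β : worldQ 0 x * β = 0 := by nlinarith [mul_nonneg hQ0 hα, mul_nonneg hQ0 hβ, mul_nonneg hQ6 hδ0]
    by_cases h0 : 0 < worldQ 0 x
    · have hα0 : α = 0 := by rcases mul_eq_zero.1 hQ0α with h | h; exact absurd h (ne_of_gt h0); exact h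
      have hβ0 : β = 0 := by rcases mul_eq_zero.1 hQ0β with h | h; exact absurd h (ne_of_gt h0); exact h
      subst hα0; subst hβ0
      have : 0 ≤ ε := by linarith
      nlinarith [mul_nonneg nE3 this]
    · have hQ0' : worldQ 0 x = 0 := le_antisymm (not_lt.1 h0) hQ0
      obtain ⟨dA, dB3, dE3⟩ := blob_dominations x hx
      rw [dA hQ0', dB3 hQ0', dE3 (by rw [hQ0', hQ3', add_zero])]
      simp

end KNGoodGMgc

end Summit.CriticalPhenomena.PercolationContinuityZ3.Theorems

end
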